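import Mathlib.Analysis.Complex.JensenFormula
import Literature.Analysis.Complex.LogDerivZerosDisc
import Literature.NumberTheory.LFunctions.DirichletLFunctionBounds
import HarnessLib

/-!
# `L'/L(s, χ)` in the critical strip, uniformly in `q`: Jensen count and local partial fraction
# on the discs `|s − (2 + it)| ≤ 38/25` (Montgomery–Vaughan Lemma 12.1 / Thm. 10.13 for `L(s, χ)`)

Topic `Literature/NumberTheory/LFunctions`. Everything in this file is PROVED (theorems only).

For a non-principal Dirichlet character `χ` modulo `q`, `L(s, χ)` is entire (Mathlib), bounded by
`q ‖s‖ Z` on `σ ≥ 1/4` (`Z = ∑ n^{-5/4}`, the tree's crude MV Lemma 10.15,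
`Literature.NumberTheory.LFunctions.DirichletZFR.norm_LFunction_le_of_re_ge`) and bounded below
by `1/2` at `2 + it` (`Literature.NumberTheory.LFunctions.DirichletZFR.norm_LFunction_ge`). On the
discs `|s − (2 + it)| ≤ 7/4` (which stay in `σ ≥ 1/4`) this is all that the local theory of
`f'/f` needs, and we obtain, with constants ABSOLUTE (independent of `q`, `χ`, `t`) and the
quantity `ℒ = log q + log(|t| + 4)` of MV §11:

* `Literature.NumberTheory.LFunctions.DirichletDisc.exists_sum_zeroOrder_le_of_subset_closedBall`
  — **Jensen** (Mathlib's `AnalyticOnNhd.sum_divisor_le`): for `0 < R < 7/4` there is `C(R)` with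
  `∑_{ρ ∈ S} m(ρ) ≤ C ℒ` for every finite set `S` of zeros of `L(s, χ)` in `|s − (2 + it)| ≤ R`
  (MV Thm. 10.13 / (10.29): "`N(T + 1, χ) − N(T, χ) ≪ log qT`", the half reached from the right);
* `Literature.NumberTheory.LFunctions.DirichletDisc.discZeros χ t` — the zeros of `L(s, χ)` in
  `|s − (2 + it)| ≤ 81/50` (support of Mathlib's `divisor`), weights
  `Literature.NumberTheory.LFunctions.DirichletDisc.discDivisor χ t` = the multiplicity
  `Literature.NumberTheory.LFunctions.DirichletDisc.zeroOrder χ` (`discZeros_prop`), and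
  `Literature.NumberTheory.LFunctions.DirichletDisc.exists_sum_discZeros_le` (`∑ m(ρ) ≤ C ℒ`);
* `Literature.NumberTheory.LFunctions.DirichletDisc.exists_norm_logDeriv_sub_sum_le` —
  **MV Lemma 12.1 for `L(s, χ)`, disc form, all real `t`**: an absolute `C` with
  `‖L'/L(s, χ) − ∑_{ρ ∈ discZeros χ t} m(ρ)/(s − ρ)‖ ≤ C ℒ` for `|s − (2 + it)| ≤ 38/25` and
  `L(s, χ) ≠ 0`; the disc `|s − (2 + it)| ≤ 38/25` contains `σ + it'` for `1/2 ≤ σ ≤ 2`,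
  `|t' − t| ≤ 1/20` (`mem_closedBall_of_re_mem_Icc`), so this is the partial fraction of `L'/L`
  on the half-strip `σ ≥ 1/2` (MV Lemma 12.6 states it on `−1 ≤ σ ≤ 2` via the Hadamard product;
  the right half is what the tree's bounds on `σ ≥ 1/4` give without the functional equation).

The radii are `38/25 < 39/25 < 81/50 < 7/4` in the four-radii Lemma α of the tree
(`Literature.Analysis.Complex.norm_logDeriv_sub_sum_le`, Titchmarsh §3.9 Lemma α); the companion file
`ZetaLogDerivDisc.lean` does the same for `ζ₁ = (s − 1)ζ(s)` (principal character).

## References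

* H. L. Montgomery, R. C. Vaughan, *Multiplicative Number Theory I. Classical Theory*, Cambridge
  Stud. Adv. Math. 97, CUP 2007: Lemma 6.3, Thm. 10.13 with (10.29), Lemma 12.1, Lemma 12.6
  (`MontgomeryVaughan2007`).
* E. C. Titchmarsh, *The Theory of the Riemann Zeta-Function*, 2nd ed., OUP 1986, §3.9 Lemma α
  (`Titchmarsh1986`).
-/

noncomputable section

open Complex Set Metric Filter Topology MeromorphicOn Real

namespace Literature.NumberTheory.LFunctions.DirichletDisc

variable {q : ℕ} [NeZero q]

/-! ### The absolute constant `Z = ∑ n^{-5/4}`; the quantity `ℒ = log q + log(|t| + 4)` is the tree's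
(`Literature.NumberTheory.LFunctions.DirichletZFR.one_le_ell`: `ℒ ≥ 1`) -/

/-- The absolute constant `Z = ∑_{n ≥ 1} n^{-5/4}` of the crude bound `‖L(s, χ)‖ ≤ q‖s‖Z`
(`Literature.NumberTheory.LFunctions.DirichletZFR.norm_LFunction_le_of_re_ge`). [folklore] -/
def Zc : ℝ := ∑' n : ℕ, ((n + 1 : ℕ) : ℝ) ^ (-(5 / 4 : ℝ))

/-- `Z ≥ 1`. [folklore] -/
theorem one_le_Zc : 1 ≤ Zc := DirichletZFR.one_le_tsum_rpow

/-! ### Geometry of the discs centred at `2 + it` -/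

/-- On `|z − (2 + it)| ≤ r`: `Re z ≥ 2 − r`. [folklore] -/
theorem disc_re_ge {t r : ℝ} {z : ℂ} (hz : z ∈ closedBall (2 + (t : ℂ) * I) r) : 2 - r ≤ z.re := by
  rw [mem_closedBall, dist_eq_norm] at hz
  have h := (abs_re_le_norm (z - (2 + t * I))).trans hz
  simp only [sub_re, add_re, re_ofNat, mul_re, ofReal_re, I_re, mul_zero, ofReal_im, I_im,
    mul_one, sub_self, add_zero] at h
  rw [abs_le] at h
  linarith [h.1]

/-- On `|z − (2 + it)| ≤ r`: `|Im z − t| ≤ r`. [folklore] -/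
theorem disc_abs_im_sub_le {t r : ℝ} {z : ℂ} (hz : z ∈ closedBall (2 + (t : ℂ) * I) r) :
    |z.im - t| ≤ r := by
  rw [mem_closedBall, dist_eq_norm] at hz
  have h := (abs_im_le_norm (z - (2 + t * I))).trans hz
  simpa only [sub_im, add_im, im_ofNat, mul_im, ofReal_re, I_im, mul_one, ofReal_im, I_re,
    mul_zero, add_zero, zero_add] using h

/-- On `|z − (2 + it)| ≤ 7/4`: `‖z‖ ≤ |t| + 4`. [folklore] -/
theorem disc_norm_le {t : ℝ} {z : ℂ} (hz : z ∈ closedBall (2 + (t : ℂ) * I) (7 / 4)) :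
    ‖z‖ ≤ |t| + 4 := by
  rw [mem_closedBall, dist_eq_norm] at hz
  have hc : ‖(2 : ℂ) + t * I‖ ≤ 2 + |t| := by
    refine (norm_add_le _ _).trans ?_
    rw [Complex.norm_ofNat, norm_mul, norm_real, norm_I, mul_one, Real.norm_eq_abs]
  have h3 : ‖z‖ ≤ ‖(2 : ℂ) + t * I‖ + ‖z - (2 + t * I)‖ := by
    calc ‖z‖ = ‖(2 + t * I) + (z - (2 + t * I))‖ := by ring_nf
      _ ≤ _ := norm_add_le _ _
  linarith

/-- The point `σ + it'` with `1/2 ≤ σ ≤ 2` and `|t' − t| ≤ 1/20` lies in the disc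
`|s − (2 + it)| ≤ 38/25` (indeed `(3/2)² + (1/20)² ≤ (38/25)²`). [folklore] -/
theorem mem_closedBall_of_re_mem_Icc {σ t t' : ℝ} (hσ : σ ∈ Icc (1 / 2 : ℝ) 2)
    (ht : |t' - t| ≤ 1 / 20) :
    (σ : ℂ) + t' * I ∈ closedBall (2 + (t : ℂ) * I) (38 / 25) := by
  rw [mem_closedBall, dist_eq_norm,
    show (σ : ℂ) + t' * I - (2 + t * I) = ((σ - 2 : ℝ) : ℂ) + ((t' - t : ℝ) : ℂ) * I by
      push_cast; ring, Complex.norm_add_mul_I]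
  have h1 : (σ - 2) ^ 2 ≤ (3 / 2) ^ 2 := by nlinarith [hσ.1, hσ.2]
  have h2 : (t' - t) ^ 2 ≤ (1 / 20) ^ 2 := by
    have h := abs_le.1 ht
    nlinarith [h.1, h.2]
  calc √((σ - 2) ^ 2 + (t' - t) ^ 2) ≤ √((38 / 25) ^ 2) := Real.sqrt_le_sqrt (by nlinarith)
    _ = 38 / 25 := Real.sqrt_sq (by norm_num)

/-! ### `L(s, χ)` on the discs `|s − (2 + it)| ≤ 7/4` -/

/-- **Growth on the disc**: for `χ ≠ χ₀` mod `q` and `|z − (2 + it)| ≤ 7/4` (so `Re z ≥ 1/4`),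
`‖L(z, χ)‖ ≤ q (|t| + 4) Z`. [cite: MontgomeryVaughan2007, Lemma 10.15] -/
theorem norm_LFunction_le_of_mem_closedBall (χ : DirichletCharacter ℂ q) (hχ : χ ≠ 1) (t : ℝ)
    {z : ℂ} (hz : z ∈ closedBall (2 + (t : ℂ) * I) (7 / 4)) :
    ‖χ.LFunction z‖ ≤ q * (|t| + 4) * Zc := by
  have hre : 1 / 4 ≤ z.re := by have := disc_re_ge hz; linarith
  have hn := disc_norm_le hz
  calc ‖χ.LFunction z‖ ≤ q * ‖z‖ * Zc := DirichletZFR.norm_LFunction_le_of_re_ge χ hχ hre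
    _ ≤ q * (|t| + 4) * Zc := by
        have hZ : 0 ≤ Zc := zero_le_one.trans one_le_Zc
        gcongr

/-- **Lower bound at the centre**: `‖L(2 + it, χ)‖ ≥ 1/2` (`‖L(s, χ)‖ ≥ (σ−1)/σ` on `σ > 1`).
[cite: MontgomeryVaughan2007, Lemma 11.1 (proof)] -/
theorem half_le_norm_LFunction_two_add (χ : DirichletCharacter ℂ q) (t : ℝ) :
    1 / 2 ≤ ‖χ.LFunction (2 + t * I)‖ := by
  have h := DirichletZFR.norm_LFunction_ge χ (s := 2 + t * I) (by simp)
  have hre : (2 + (t : ℂ) * I).re = 2 := by simp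
  rw [hre] at h
  norm_num at h
  exact h

/-- `L(2 + it, χ) ≠ 0`. [folklore] -/
theorem LFunction_two_add_ne_zero (χ : DirichletCharacter ℂ q) (t : ℝ) :
    χ.LFunction (2 + t * I) ≠ 0 := by
  intro h
  have := half_le_norm_LFunction_two_add χ t
  rw [h, norm_zero] at this
  linarith

/-- The Jensen / Borel–Carathéodory quantity: `log(q(|t|+4)Z/‖L(2+it, χ)‖) ≤ (log(2Z) + 1) ℒ`.
[folklore] -/
theorem log_bound_div_norm_le (χ : DirichletCharacter ℂ q) (t : ℝ) :
    Real.log (q * (|t| + 4) * Zc / ‖χ.LFunction (2 + t * I)‖) ≤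
      (Real.log (2 * Zc) + 1) * (Real.log q + Real.log (|t| + 4)) := by
  have hq : (1 : ℝ) ≤ q := by exact_mod_cast NeZero.one_le
  have hZ := one_le_Zc
  have ht4 : 4 ≤ |t| + 4 := by linarith [abs_nonneg t]
  have hℒ := DirichletZFR.one_le_ell q t
  have hL := half_le_norm_LFunction_two_add χ t
  have hpos : 0 < ‖χ.LFunction (2 + t * I)‖ := by linarith
  have h2Z : 0 ≤ Real.log (2 * Zc) := Real.log_nonneg (by linarith)
  have h1 : Real.log (q * (|t| + 4) * Zc / ‖χ.LFunction (2 + t * I)‖) ≤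
      Real.log (2 * Zc * q * (|t| + 4)) := by
    refine Real.log_le_log (by positivity) ?_
    rw [div_le_iff₀ hpos]
    have : (q : ℝ) * (|t| + 4) * Zc * 1 ≤ (q * (|t| + 4) * Zc) * (2 * ‖χ.LFunction (2 + t * I)‖) :=
      mul_le_mul_of_nonneg_left (by linarith) (by positivity)
    linarith
  have h2 : Real.log (2 * Zc * q * (|t| + 4)) =
      Real.log (2 * Zc) + Real.log q + Real.log (|t| + 4) := by
    rw [Real.log_mul (by positivity) (by positivity), Real.log_mul (by positivity) (by positivity)]
  rw [h2] at h1
  refine h1.trans ?_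
  nlinarith

/-- `L(s, χ)`, `χ ≠ χ₀`, is analytic on a neighbourhood of every point of every closed disc. [folklore] -/
theorem analyticOnNhd_LFunction (χ : DirichletCharacter ℂ q) (hχ : χ ≠ 1) (c : ℂ) (R : ℝ) :
    AnalyticOnNhd ℂ χ.LFunction (closedBall c R) := fun z _ ↦
  (DirichletCharacter.differentiable_LFunction hχ).analyticAt z

/-! ### Multiplicities -/

/-- The multiplicity `m(u)` of `u` as a zero of `L(s, χ)` (Mathlib's `analyticOrderNatAt`; it is
`0` unless `L(u, χ) = 0`). [folklore] -/
def zeroOrder (χ : DirichletCharacter ℂ q) (u : ℂ) : ℕ := analyticOrderNatAt χ.LFunction u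

/-- `L(s, χ)` (`χ ≠ χ₀`) has finite order everywhere: it is entire and `L(2, χ) ≠ 0`. [folklore] -/
theorem analyticOrderAt_LFunction_ne_top (χ : DirichletCharacter ℂ q) (hχ : χ ≠ 1) (u : ℂ) :
    analyticOrderAt χ.LFunction u ≠ ⊤ := by
  intro htop
  have h0 : χ.LFunction =ᶠ[𝓝 u] 0 := analyticOrderAt_eq_top.mp htop
  have hall : AnalyticOnNhd ℂ χ.LFunction univ := fun z _ ↦
    (DirichletCharacter.differentiable_LFunction hχ).analyticAt z
  have := hall.eqOn_zero_of_preconnected_of_eventuallyEq_zero isPreconnected_univ (mem_univ u) h0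
    (mem_univ (2 + (0 : ℝ) * I))
  exact LFunction_two_add_ne_zero χ 0 this

/-- `m(u) ≥ 1 ↔ L(u, χ) = 0` (`χ ≠ χ₀`). [folklore] -/
theorem zeroOrder_pos_iff (χ : DirichletCharacter ℂ q) (hχ : χ ≠ 1) (u : ℂ) :
    0 < zeroOrder χ u ↔ χ.LFunction u = 0 := by
  have han : AnalyticAt ℂ χ.LFunction u := (DirichletCharacter.differentiable_LFunction hχ).analyticAt u
  rw [zeroOrder, pos_iff_ne_zero, ne_eq, ← Nat.cast_inj (R := ℕ∞),
    Nat.cast_analyticOrderNatAt (analyticOrderAt_LFunction_ne_top χ hχ u), Nat.cast_zero,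
    han.analyticOrderAt_eq_zero, not_not]

/-- The multiplicity as the meromorphic order: `m(u) = (meromorphicOrderAt L u).untop₀`. [folklore] -/
theorem meromorphicOrderAt_untop₀_eq_zeroOrder (χ : DirichletCharacter ℂ q) (hχ : χ ≠ 1) (u : ℂ) :
    (meromorphicOrderAt χ.LFunction u).untop₀ = (zeroOrder χ u : ℤ) := by
  have han : AnalyticAt ℂ χ.LFunction u := (DirichletCharacter.differentiable_LFunction hχ).analyticAt u
  rw [han.meromorphicOrderAt_eq, zeroOrder,
    ← Nat.cast_analyticOrderNatAt (analyticOrderAt_LFunction_ne_top χ hχ u)]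
  simp

/-! ### Jensen counts -/

/-- **Jensen count in the discs `|s − (2 + it)| ≤ R`, `R < 7/4`, uniformly in `q`** (MV Thm. 10.13
/ (10.29) "`N(T+1, χ) − N(T, χ) ≪ log qT`", the half reached by Jensen's inequality from the right):
for `0 < R < 7/4` there is `C = C(R)` such that for every `q`, every `χ ≠ χ₀` mod `q`, every real
`t` and every finite set `S` of zeros of `L(s, χ)` in the disc, `∑_{ρ ∈ S} m(ρ) ≤ C ℒ`.
[cite: MontgomeryVaughan2007, Thm. 10.13] -/
theorem exists_sum_zeroOrder_le_of_subset_closedBall {R : ℝ} (hR : 0 < R) (hR' : R < 7 / 4) :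
    ∃ C : ℝ, 0 < C ∧ ∀ (q : ℕ) [NeZero q] (χ : DirichletCharacter ℂ q), χ ≠ 1 → ∀ t : ℝ,
      ∀ S : Finset ℂ, (∀ u ∈ S, u ∈ closedBall (2 + (t : ℂ) * I) R ∧ χ.LFunction u = 0) →
        ∑ ρ ∈ S, (zeroOrder χ ρ : ℝ) ≤ C * (Real.log q + Real.log (|t| + 4)) := by
  set A₀ : ℝ := Real.log (2 * Zc) + 1 with hA₀
  have hA₀0 : 0 < A₀ := by
    rw [hA₀]; have := Real.log_nonneg (show (1 : ℝ) ≤ 2 * Zc by linarith [one_le_Zc]); linarith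
  have hlog : 0 < Real.log ((7 : ℝ) / 4 / R) := Real.log_pos ((one_lt_div hR).2 hR')
  refine ⟨A₀ / Real.log ((7 : ℝ) / 4 / R), by positivity, fun q _ χ hχ t S hS ↦ ?_⟩
  classical
  set c : ℂ := 2 + t * I with hc
  have hq : (1 : ℝ) ≤ q := by exact_mod_cast NeZero.one_le
  have ht4 : 4 ≤ |t| + 4 := by linarith [abs_nonneg t]
  have hM : (1 : ℝ) ≤ q * (|t| + 4) * Zc := by
    have := one_le_Zc
    calc (1 : ℝ) = 1 * 1 * 1 := by ring
      _ ≤ q * (|t| + 4) * Zc := by gcongr; linarith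
  have han : AnalyticOnNhd ℂ χ.LFunction (closedBall c |(7 : ℝ) / 4|) :=
    analyticOnNhd_LFunction χ hχ _ _
  have hJ := AnalyticOnNhd.sum_divisor_le (f := χ.LFunction) (c := c) (r := R)
    (R := (7 : ℝ) / 4) (M := q * (|t| + 4) * Zc) (by rwa [abs_of_pos hR])
    (by rwa [abs_of_pos hR, abs_of_pos (by norm_num : (0 : ℝ) < 7 / 4)]) hM han
    (LFunction_two_add_ne_zero χ t)
    (fun z hz ↦ norm_LFunction_le_of_mem_closedBall χ hχ t (by
      rw [abs_of_pos (by norm_num : (0 : ℝ) < 7 / 4)] at hz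
      exact sphere_subset_closedBall hz))
  rw [abs_of_pos hR] at hJ
  -- the sum over `S` is at most the Jensen count
  set D := divisor χ.LFunction (closedBall c R) with hD
  have hanR : AnalyticOnNhd ℂ χ.LFunction (closedBall c R) := analyticOnNhd_LFunction χ hχ _ _
  have hD0 : ∀ u, 0 ≤ D u := fun u ↦ hanR.divisor_nonneg u
  have hfin : (Function.support D).Finite := D.finiteSupport (isCompact_closedBall c R)
  have hSD : ∀ u ∈ S, (zeroOrder χ u : ℤ) = D u := by
    intro u hu
    obtain ⟨huB, -⟩ := hS u hu
    rw [hD, divisor_apply hanR.meromorphicOn huB, meromorphicOrderAt_untop₀_eq_zeroOrder χ hχ]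
  have hle : ∑ u ∈ S, (zeroOrder χ u : ℤ) ≤ ∑ᶠ u, D u := by
    rw [finsum_eq_sum_of_support_subset D (s := hfin.toFinset ∪ S) (by intro u hu; simp [hu])]
    calc ∑ u ∈ S, (zeroOrder χ u : ℤ) = ∑ u ∈ S, D u := Finset.sum_congr rfl hSD
      _ ≤ ∑ u ∈ hfin.toFinset ∪ S, D u :=
          Finset.sum_le_sum_of_subset_of_nonneg Finset.subset_union_right fun u _ _ ↦ hD0 u
  have hle' : (∑ u ∈ S, (zeroOrder χ u : ℝ)) ≤ ((∑ᶠ u, D u : ℤ) : ℝ) := by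
    have : ((∑ u ∈ S, (zeroOrder χ u : ℤ) : ℤ) : ℝ) ≤ ((∑ᶠ u, D u : ℤ) : ℝ) := by
      exact_mod_cast hle
    simpa using this
  refine hle'.trans (hJ.trans ?_)
  rw [div_mul_eq_mul_div]
  exact div_le_div_of_nonneg_right (log_bound_div_norm_le χ t) hlog.le

/-! ### The zeros in the disc `|s − (2 + it)| ≤ 81/50` -/

/-- The divisor of `L(s, χ)` on the closed disc `|s − (2 + it)| ≤ 81/50` (Mathlib's
`MeromorphicOn.divisor`). For `χ ≠ χ₀` (the only case used: `L(s, χ)` entire) it is `≥ 0` and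
supported on the zeros of `L(s, χ)` in the disc; for `χ = χ₀` the pole `s = 1` may lie in the disc
and contribute `−1`, and no statement below concerns that case. [folklore] -/
def discDivisor (χ : DirichletCharacter ℂ q) (t : ℝ) :
    Function.locallyFinsuppWithin (closedBall (2 + (t : ℂ) * I) (81 / 50)) ℤ :=
  divisor χ.LFunction (closedBall (2 + (t : ℂ) * I) (81 / 50))

/-- For `χ ≠ χ₀`: the zeros of `L(s, χ)` in the closed disc `|s − (2 + it)| ≤ 81/50`, each listed
once — the (finite) support of `discDivisor χ t` (`mem_discZeros`). [folklore] -/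
def discZeros (χ : DirichletCharacter ℂ q) (t : ℝ) : Finset ℂ :=
  ((discDivisor χ t).finiteSupport (isCompact_closedBall _ _)).toFinset

/-- On the disc, the divisor of `L(s, χ)` at `u` is the multiplicity `m(u) = zeroOrder χ u`
(`χ ≠ χ₀`). [folklore] -/
theorem discDivisor_eq_zeroOrder {χ : DirichletCharacter ℂ q} (hχ : χ ≠ 1) {t : ℝ} {u : ℂ}
    (hu : u ∈ closedBall (2 + (t : ℂ) * I) (81 / 50)) :
    discDivisor χ t u = (zeroOrder χ u : ℤ) := by
  rw [discDivisor, divisor_apply (analyticOnNhd_LFunction χ hχ _ _).meromorphicOn hu,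
    meromorphicOrderAt_untop₀_eq_zeroOrder χ hχ]

/-- The divisor of `L(s, χ)` on the disc is non-negative (`χ ≠ χ₀`). [folklore] -/
theorem discDivisor_nonneg {χ : DirichletCharacter ℂ q} (hχ : χ ≠ 1) (t : ℝ) (u : ℂ) :
    0 ≤ discDivisor χ t u :=
  (analyticOnNhd_LFunction χ hχ _ _).divisor_nonneg u

/-- **Membership.** For `χ ≠ χ₀`: `u ∈ discZeros χ t` iff `u` lies in the disc
`|u − (2 + it)| ≤ 81/50` and `L(u, χ) = 0`. [folklore] -/
theorem mem_discZeros {χ : DirichletCharacter ℂ q} (hχ : χ ≠ 1) {t : ℝ} {u : ℂ} :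
    u ∈ discZeros χ t ↔ u ∈ closedBall (2 + (t : ℂ) * I) (81 / 50) ∧ χ.LFunction u = 0 := by
  rw [discZeros, Set.Finite.mem_toFinset, Function.mem_support]
  constructor
  · intro h
    have hu : u ∈ closedBall (2 + (t : ℂ) * I) (81 / 50) :=
      (discDivisor χ t).supportWithinDomain (Function.mem_support.2 h)
    refine ⟨hu, ?_⟩
    rw [discDivisor_eq_zeroOrder hχ hu] at h
    have h' : 0 < zeroOrder χ u := by
      rcases Nat.eq_zero_or_pos (zeroOrder χ u) with h0 | h0
      · rw [h0] at h; simp at h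
      · exact h0
    exact (zeroOrder_pos_iff χ hχ u).1 h'
  · rintro ⟨hu, h0⟩
    rw [discDivisor_eq_zeroOrder hχ hu]
    have := (zeroOrder_pos_iff χ hχ u).2 h0
    exact_mod_cast this.ne'

/-- Elements of `discZeros χ t` (`χ ≠ χ₀`) are zeros of `L(s, χ)` with `|Im ρ − t| ≤ 81/50`,
`Re ρ ≥ 19/50` (hence `Re ρ < 1` and `‖ρ‖ ≥ 19/50`), and their weight is
`m(ρ) = zeroOrder χ ρ ≥ 1`. [folklore] -/
theorem discZeros_prop {χ : DirichletCharacter ℂ q} (hχ : χ ≠ 1) {t : ℝ} {ρ : ℂ}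
    (h : ρ ∈ discZeros χ t) :
    χ.LFunction ρ = 0 ∧ |ρ.im - t| ≤ 81 / 50 ∧ 19 / 50 ≤ ρ.re ∧ ρ.re < 1 ∧
      discDivisor χ t ρ = (zeroOrder χ ρ : ℤ) ∧ 1 ≤ zeroOrder χ ρ := by
  obtain ⟨h1, h2⟩ := (mem_discZeros hχ).1 h
  refine ⟨h2, disc_abs_im_sub_le h1, by have := disc_re_ge h1; linarith, ?_,
    discDivisor_eq_zeroOrder hχ h1, (zeroOrder_pos_iff χ hχ ρ).2 h2⟩
  by_contra hre
  exact DirichletCharacter.LFunction_ne_zero_of_one_le_re χ (Or.inl hχ) (not_lt.1 hre) h2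

/-- **Jensen count of the disc `|s − (2 + it)| ≤ 81/50`, uniformly in `q`:** an absolute `C` with
`∑_{ρ ∈ discZeros χ t} m(ρ) ≤ C ℒ` for all `q`, `χ ≠ χ₀` mod `q`, `t`, stated for the divisor
weights (`= zeroOrder`, `discZeros_prop`). [cite: MontgomeryVaughan2007, Thm. 10.13] -/
theorem exists_sum_discZeros_le :
    ∃ C : ℝ, 0 < C ∧ ∀ (q : ℕ) [NeZero q] (χ : DirichletCharacter ℂ q), χ ≠ 1 → ∀ t : ℝ,
      ∑ ρ ∈ discZeros χ t, (discDivisor χ t ρ : ℝ) ≤ C * (Real.log q + Real.log (|t| + 4)) := by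
  obtain ⟨C, hC0, hC⟩ := exists_sum_zeroOrder_le_of_subset_closedBall
    (R := 81 / 50) (by norm_num) (by norm_num)
  refine ⟨C, hC0, fun q _ χ hχ t ↦ le_of_eq_of_le ?_ (hC q χ hχ t (discZeros χ t) fun u hu ↦
    ((mem_discZeros hχ).1 hu))⟩
  exact Finset.sum_congr rfl fun u hu ↦ by
    rw [(discZeros_prop hχ hu).2.2.2.2.1]; simp

/-! ### The partial fraction of `L'/L` -/

/-- **Montgomery–Vaughan Lemma 12.1 (12.6) for `L(s, χ)`, disc form, all real `t`, uniformly in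
`q`.** There is an absolute constant `C` such that for every `q`, every `χ ≠ χ₀` mod `q`, every
real `t` and every `s` with `|s − (2 + it)| ≤ 38/25` (this covers `1/2 ≤ σ ≤ 2` at heights
`|t' − t| ≤ 1/20`, `mem_closedBall_of_re_mem_Icc`) and `L(s, χ) ≠ 0`,
`‖L'/L(s, χ) − ∑_{ρ ∈ discZeros χ t} m(ρ)/(s − ρ)‖ ≤ C (log q + log(|t| + 4))`,
`m(ρ)` the divisor weight (`= zeroOrder χ ρ`). MV: "`L'/L(s, χ) = ∑_{|γ−t| ≤ 1} 1/(s − ρ) + O(log qτ)`".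
(From `Literature.Analysis.Complex.norm_logDeriv_sub_sum_le` with radii `38/25 < 39/25 < 81/50 < 7/4`,
the bound `‖L‖ ≤ q(|t|+4)Z` on the disc, `‖L(2+it, χ)‖ ≥ 1/2`, and the Jensen count.)
[cite: MontgomeryVaughan2007, Lemma 12.6] -/
theorem exists_norm_logDeriv_sub_sum_le :
    ∃ C : ℝ, 0 < C ∧ ∀ (q : ℕ) [NeZero q] (χ : DirichletCharacter ℂ q), χ ≠ 1 → ∀ t : ℝ,
      ∀ s ∈ closedBall (2 + (t : ℂ) * I) (38 / 25), χ.LFunction s ≠ 0 →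
        ‖logDeriv χ.LFunction s - ∑ ρ ∈ discZeros χ t, (discDivisor χ t ρ : ℂ) / (s - ρ)‖ ≤
          C * (Real.log q + Real.log (|t| + 4)) := by
  obtain ⟨C₂, hC₂0, hC₂⟩ := exists_sum_discZeros_le
  set A₀ : ℝ := Real.log (2 * Zc) + 1 with hA₀
  set K : ℝ := 2 * ((39 : ℝ) / 25) / ((81 / 50 - 39 / 25) * (39 / 25 - 38 / 25)) with hK
  set L₀ : ℝ := Real.log ((7 : ℝ) / 4 / (7 / 4 - 81 / 50)) with hL₀
  have hK0 : 0 < K := by rw [hK]; norm_num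
  have hL₀0 : 0 < L₀ := by rw [hL₀]; exact Real.log_pos (by norm_num)
  have hA₀0 : 0 < A₀ := by
    rw [hA₀]; have := Real.log_nonneg (show (1 : ℝ) ≤ 2 * Zc by linarith [one_le_Zc]); linarith
  refine ⟨K * (A₀ + C₂ * L₀ + 1), by positivity, fun q _ χ hχ t s hs hL ↦ ?_⟩
  have hℒ := DirichletZFR.one_le_ell q t
  have h := Literature.Analysis.Complex.norm_logDeriv_sub_sum_le (f := χ.LFunction)
    (c := 2 + (t : ℂ) * I) (r := 38 / 25) (r₁ := 39 / 25) (R₂ := 81 / 50) (R := 7 / 4)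
    (B := q * (|t| + 4) * Zc) (by norm_num) (by norm_num) (by norm_num) (by norm_num)
    (analyticOnNhd_LFunction χ hχ _ _) (LFunction_two_add_ne_zero χ t)
    (fun z hz ↦ norm_LFunction_le_of_mem_closedBall χ hχ t hz) hs hL
  -- the sums in `h` are over `discZeros χ t` with the weights `discDivisor χ t`
  change ‖logDeriv χ.LFunction s - ∑ ρ ∈ discZeros χ t, (discDivisor χ t ρ : ℂ) / (s - ρ)‖ ≤
    K * (Real.log (q * (|t| + 4) * Zc / ‖χ.LFunction (2 + t * I)‖) +
      (∑ ρ ∈ discZeros χ t, (discDivisor χ t ρ : ℝ)) * L₀ + 1) at h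
  refine h.trans ?_
  have hLg := log_bound_div_norm_le χ t
  rw [← hA₀] at hLg
  have hN := hC₂ q χ hχ t
  have hsum0 : 0 ≤ ∑ ρ ∈ discZeros χ t, (discDivisor χ t ρ : ℝ) :=
    Finset.sum_nonneg fun ρ _ ↦ by exact_mod_cast discDivisor_nonneg hχ t ρ
  set ℒ := Real.log q + Real.log (|t| + 4) with hℒdef
  calc K * (Real.log (q * (|t| + 4) * Zc / ‖χ.LFunction (2 + t * I)‖) +
        (∑ ρ ∈ discZeros χ t, (discDivisor χ t ρ : ℝ)) * L₀ + 1)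
      ≤ K * (A₀ * ℒ + (C₂ * ℒ) * L₀ + 1) := by gcongr
    _ ≤ K * (A₀ * ℒ + (C₂ * ℒ) * L₀ + ℒ) := by gcongr
    _ = K * (A₀ + C₂ * L₀ + 1) * ℒ := by ring

/-- **Corollary (crude bound off the zeros).** With the constant of
`exists_norm_logDeriv_sub_sum_le` and that of `exists_sum_discZeros_le`: if `|s − (2 + it)| ≤ 38/25`
and every zero `ρ` of `L(s, χ)` in `|ρ − (2 + it)| ≤ 81/50` has `‖s − ρ‖ ≥ d > 0`, then
`‖L'/L(s, χ)‖ ≤ C (1 + 1/d) ℒ`. [cite: MontgomeryVaughan2007, Lemma 12.6] -/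
theorem exists_norm_logDeriv_le_of_dist :
    ∃ C : ℝ, 0 < C ∧ ∀ (q : ℕ) [NeZero q] (χ : DirichletCharacter ℂ q), χ ≠ 1 → ∀ t : ℝ,
      ∀ s ∈ closedBall (2 + (t : ℂ) * I) (38 / 25), ∀ d : ℝ, 0 < d →
        (∀ ρ ∈ discZeros χ t, d ≤ ‖s - ρ‖) →
        χ.LFunction s ≠ 0 ∧
          ‖logDeriv χ.LFunction s‖ ≤ C * (1 + 1 / d) * (Real.log q + Real.log (|t| + 4)) := by
  obtain ⟨C₁, hC₁0, hC₁⟩ := exists_norm_logDeriv_sub_sum_le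
  obtain ⟨C₂, hC₂0, hC₂⟩ := exists_sum_discZeros_le
  refine ⟨max C₁ C₂, lt_max_of_lt_left hC₁0, fun q _ χ hχ t s hs d hd hdist ↦ ?_⟩
  set ℒ := Real.log q + Real.log (|t| + 4) with hℒdef
  have hℒ1 : 1 ≤ ℒ := DirichletZFR.one_le_ell q t
  -- `s` is not a zero: a zero at `s` would lie in `discZeros χ t` at distance `0 < d`
  have hL : χ.LFunction s ≠ 0 := by
    intro h0
    have hs' : s ∈ closedBall (2 + (t : ℂ) * I) (81 / 50) :=
      closedBall_subset_closedBall (by norm_num) hs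
    have hmem : s ∈ discZeros χ t := (mem_discZeros hχ).2 ⟨hs', h0⟩
    have := hdist s hmem
    rw [sub_self, norm_zero] at this
    linarith
  refine ⟨hL, ?_⟩
  have h1 := hC₁ q χ hχ t s hs hL
  have hsum : ‖∑ ρ ∈ discZeros χ t, (discDivisor χ t ρ : ℂ) / (s - ρ)‖ ≤ (C₂ * ℒ) / d := by
    have hterm : ∀ ρ ∈ discZeros χ t,
        ‖(discDivisor χ t ρ : ℂ) / (s - ρ)‖ ≤ (discDivisor χ t ρ : ℝ) / d := by
      intro ρ hρ
      have hm0 : (0 : ℝ) ≤ discDivisor χ t ρ := by exact_mod_cast discDivisor_nonneg hχ t ρ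
      rw [norm_div, Complex.norm_intCast, abs_of_nonneg hm0]
      exact div_le_div_of_nonneg_left hm0 hd (hdist ρ hρ)
    calc ‖∑ ρ ∈ discZeros χ t, (discDivisor χ t ρ : ℂ) / (s - ρ)‖
        ≤ ∑ ρ ∈ discZeros χ t, ‖(discDivisor χ t ρ : ℂ) / (s - ρ)‖ := norm_sum_le _ _
      _ ≤ ∑ ρ ∈ discZeros χ t, (discDivisor χ t ρ : ℝ) / d := Finset.sum_le_sum hterm
      _ = (∑ ρ ∈ discZeros χ t, (discDivisor χ t ρ : ℝ)) / d := by rw [Finset.sum_div]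
      _ ≤ (C₂ * ℒ) / d := div_le_div_of_nonneg_right (hC₂ q χ hχ t) hd.le
  have h2 : ‖logDeriv χ.LFunction s‖ ≤ C₁ * ℒ + C₂ * ℒ / d := by
    calc ‖logDeriv χ.LFunction s‖
        = ‖(logDeriv χ.LFunction s - ∑ ρ ∈ discZeros χ t, (discDivisor χ t ρ : ℂ) / (s - ρ)) +
            ∑ ρ ∈ discZeros χ t, (discDivisor χ t ρ : ℂ) / (s - ρ)‖ := by rw [sub_add_cancel]
      _ ≤ _ := norm_add_le _ _
      _ ≤ C₁ * ℒ + C₂ * ℒ / d := add_le_add h1 hsum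
  refine h2.trans ?_
  have hm1 : C₁ ≤ max C₁ C₂ := le_max_left _ _
  have hm2 : C₂ ≤ max C₁ C₂ := le_max_right _ _
  have hℒ0 : 0 ≤ ℒ := by linarith
  calc C₁ * ℒ + C₂ * ℒ / d ≤ max C₁ C₂ * ℒ + max C₁ C₂ * ℒ / d := by gcongr
    _ = max C₁ C₂ * (1 + 1 / d) * ℒ := by ring

end Literature.NumberTheory.LFunctions.DirichletDisc

end
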